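import Summits.QuantumFields.BalabanUV.Beta.GAN24.LayerPushGaugeTable

/-!
# `BalabanUV.Beta.GAN24.LayerSeamLetters` — binder row G-an2-4 ∕ (CONV-C), W-slot CT-W, route «WC-TL» ∕ «QR-LL», row **(LT-Δ) «LAYER TRANSPORT»**, K-LL-4 route (R-iv) of the OWNER
# gan24-p1 g28's W12 ∕ RULING NOTE R-gan24p1-g28-2 («GO, THIS SHAPE — type `GAN24/LayerSeamLetters` §1–§3 generic now»; my cell table `g65/KLL4-CELLS-v0.md` v0.1 §3b), PART 1:
# **SEAM LETTERS ARE BLOCK-INDICATOR COMMUTATORS OF THE COMPANION** — for a table-gauge leg whose gauge function is BLOCK-CONSTANT (`λ_{νU} = Λ_{νU} ∘ blk_M`, the shape of every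
# level of `RespStepBmDecompPsi.Psi`), the commutator letter `[S₀, λ_{νU}]` of the (b3) cell (`LayerPushGaugeTable.push₃_gaugeTable_inl_inl`) is, ENTRY BY ENTRY, the two-term
# superposition `Σ_{B ∈ {blk x, blk z}} Λ_{νU}(B)·[S₀, 𝟙_B](x,z)` of block-INDICATOR commutators — letters of exactly the σ-type (`conjV · (diagK 𝟙_B)`, the shape of `[G_j, X_y]`)
# on the blocks of the partition — and it lives on CROSS-BLOCK pairs only

NOT IN PRINT; OUR BOOKKEEPING ([folklore] entrywise algebra over `DiagonalContact.conjV_diagK_apply` and this lineage's `LayerPushGaugeTable` §1; G-an2-4 formalisation swarm, leaf prover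
`b2b-balaban-gan24-formalise-leaf-01`, gen 65, INTENT I-leaf01-g65-5).  HONEST FRAMING (cell contract, verbatim): «discharging `BetaPertH` makes Bałaban's UV stability UNCONDITIONAL —
a real constructive-QFT result; it is NOT the continuum limit and NOT the Clay problem.»  HONEST DEPENDENCY (verbatim): «continuum YM on T⁴ ⇐ BetaPertH ∧ nine spine estimates (0/9
proved); BetaPertH ⇐ (D1) ∧ (D4) ∧ CAP+tail; G-an2-4 gates asym, D1 and NE2/3/4.»

## What (generic `d`, generic partition `blk M`, generic companion `S₀`, generic block values `Λ`; no object of an2's typed system)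
§1 **`conjV_diagK_blockConst_apply`**: `conjV S₀ (diagK (Λ∘blk M)) x z a b = Σ_{B ∈ {blk M x, blk M z}} Λ B · conjV S₀ (diagK 𝟙_{blk M · = B}) x z a b`; **`…_tsum`**: the same as
   `∑' B` over ALL block labels (support ⊆ the two blocks); **`conjV_diagK_blockConst_apply_of_blk_eq`**: the entry VANISHES when `blk M x = blk M z` — the seam letter lives on
   CROSS-BLOCK pairs; `conjV_diagK_blockConst_apply_eq_indicator`: `= 𝟙[blk x ≠ blk z]·(Λ(blk z) − Λ(blk x))·S₀ x z a b`.
§2 UNDER THE SLOT-WARD BINDER of `LayerPushGaugeTable` (`hWard`), for the block-constant table gauge `(ν,U) ↦ dz (Λ_{νU} ∘ blk M)`: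
   **`vertexW_blockGauge_ff`** (the table vertex IS the seam letter `Σ_{B} Λ_{νU} B·[S₀, 𝟙_B]`), **`push₃_blockGauge_inl_inl`** (the (b3) cell = the two-leg sandwich of that
   superposition, entry by entry), **`vertexW_blockGauge_ff_of_blk_eq`** (zero on same-block pairs).
PART 2 (next INTENT): the linear decomposition over blocks on the summable class (`Σ'_B Λ_{νU} B • (push₂ of [S₀, 𝟙_B])`, a Fubini) and the COUNT socket under DISPLAYED (M0)∕(Π)
for the companions' block commutators — the «one moment gain at the seams» of the cell table §3b.  NOT typed here: which companions `S₀` the σ-pieces have ((ii-T), p2 g39's first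
refusal), whether their block commutators inherit (M0)∕(INV) (p2∕leaf-06's closed forms), any estimate.  [folklore]; 0 cited facts, 0 `def`, 0 `def … : Prop`, 0 sorry.  K-LL-4 OPEN;
NOTHING of (Q-R)∕(LT)∕(Q-L)∕(C)∕(S)∕«T2Shape»∕«T2Drift»∕(hW, hWall) discharged; NEVER «G-an2-4 closed» as (CONV-C); NOT D1, NOT `BetaPertH`, NOT continuum, NOT Clay.  2026-08-22; no existing
file touched.
-/

noncomputable section

open Finset
open scoped BigOperators
open Literature.MathematicalPhysics.QuantumFieldTheory
open Literature.MathematicalPhysics.QuantumFieldTheory.Balaban1983to89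
open Literature.MathematicalPhysics.QuantumFieldTheory.Balaban1983to89.Beta
open ExpKernelCalculus (MKer Site)
open AveragingContours (blk)
open AffineAveraging (dz)
open OneStepResolventKernel (Fib)
open Summit.QuantumFields.BalabanUV.Beta.ChartConjugation (conjV)
open Summit.QuantumFields.BalabanUV.Beta.BorderedHessian (diagK conjV_diagK_apply)
open Summit.QuantumFields.BalabanUV.Beta.GAN24.Push4 (vertexW)
open Summit.QuantumFields.BalabanUV.Beta.GAN24.Push3 (push₃)
open Summit.QuantumFields.BalabanUV.Beta.GAN24.LayerPushGaugeTable (vertexW_gaugeTable_ff_eq_conjV push₃_gaugeTable_inl_inl)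

namespace Summit.QuantumFields.BalabanUV.Beta.GAN24.LayerSeamLetters

variable {d : ℕ}

/-! ## §1 The commutator with a block-constant symbol, entry by entry -/

section BlockConst

variable (S₀ : MKer (d + 1) (Fib d)) (M : ℕ) (Λ : Site (d + 1) → ℝ)

open Classical in
/-- [folklore] **THE SEAM LETTER IS A TWO-TERM SUPERPOSITION OF BLOCK-INDICATOR COMMUTATORS**: for a symbol constant on the blocks of `blk M` with values `Λ`,
`conjV S₀ (diagK (Λ∘blk)) x z a b = Σ_{B ∈ {blk x, blk z}} Λ B · conjV S₀ (diagK 𝟙_{blk · = B}) x z a b` (`conjV_diagK_apply`: both sides are `S₀ x z a b·(Λ(blk z) − Λ(blk x))`). -/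
theorem conjV_diagK_blockConst_apply (x z : Site (d + 1)) (a b : Fib d) :
    conjV S₀ (diagK (fun p _ => Λ (blk M p))) x z a b
      = ∑ B ∈ ({blk M x, blk M z} : Finset (Site (d + 1))),
          Λ B * conjV S₀ (diagK (fun p _ => if blk M p = B then (1 : ℝ) else 0)) x z a b := by
  simp only [conjV_diagK_apply]
  by_cases h : blk M x = blk M z
  · rw [h, Finset.pair_eq_singleton, Finset.sum_singleton]
    simp
  · rw [Finset.sum_pair h]
    simp [h, Ne.symm h]
    ring

open Classical in
/-- [folklore] The same as a `tsum` over ALL block labels (the support is contained in the two blocks of the kernel sites). -/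
theorem conjV_diagK_blockConst_apply_tsum (x z : Site (d + 1)) (a b : Fib d) :
    conjV S₀ (diagK (fun p _ => Λ (blk M p))) x z a b
      = ∑' B : Site (d + 1), Λ B * conjV S₀ (diagK (fun p _ => if blk M p = B then (1 : ℝ) else 0)) x z a b := by
  rw [conjV_diagK_blockConst_apply, eq_comm]
  refine tsum_eq_sum (s := ({blk M x, blk M z} : Finset (Site (d + 1)))) fun B hB => ?_
  have hx : blk M x ≠ B := fun h => hB (by simp [h])
  have hz : blk M z ≠ B := fun h => hB (by simp [h])
  simp [conjV_diagK_apply, hx, hz]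

/-- [folklore] **THE SEAM LETTER LIVES ON CROSS-BLOCK PAIRS**: if both kernel sites lie in the same block, the entry vanishes. -/
theorem conjV_diagK_blockConst_apply_of_blk_eq {x z : Site (d + 1)} (h : blk M x = blk M z) (a b : Fib d) :
    conjV S₀ (diagK (fun p _ => Λ (blk M p))) x z a b = 0 := by
  rw [conjV_diagK_apply, h, sub_self, mul_zero]

open Classical in
/-- [folklore] Indicator form: `conjV S₀ (diagK (Λ∘blk)) x z a b = 𝟙[blk x ≠ blk z]·(Λ(blk z) − Λ(blk x))·S₀ x z a b`. -/
theorem conjV_diagK_blockConst_apply_eq_indicator (x z : Site (d + 1)) (a b : Fib d) :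
    conjV S₀ (diagK (fun p _ => Λ (blk M p))) x z a b
      = (if blk M x = blk M z then (0 : ℝ) else 1) * (Λ (blk M z) - Λ (blk M x)) * S₀ x z a b := by
  rw [conjV_diagK_apply]
  by_cases h : blk M x = blk M z
  · simp [h]
  · simp [h]
    ring

/-- [folklore] A block-INDICATOR commutator entry is bounded by the companion entry: `|conjV S₀ (diagK 𝟙_B) x z a b| ≤ |S₀ x z a b|`. -/
theorem abs_conjV_diagK_indicator_le (B x z : Site (d + 1)) (a b : Fib d) :
    |conjV S₀ (diagK (fun p _ => if blk M p = B then (1 : ℝ) else 0)) x z a b| ≤ |S₀ x z a b| := by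
  classical
  rw [conjV_diagK_apply, abs_mul]
  refine mul_le_of_le_one_right (abs_nonneg _) ?_
  split_ifs <;> simp

/-- [folklore] The seam letter entry is bounded by `2·Λ̄·|S₀ x z a b|` for block values bounded by `Λ̄`, and by `0` on same-block pairs. -/
theorem abs_conjV_diagK_blockConst_le {Λbar : ℝ} (hΛ : ∀ B, |Λ B| ≤ Λbar) (x z : Site (d + 1)) (a b : Fib d) :
    |conjV S₀ (diagK (fun p _ => Λ (blk M p))) x z a b| ≤ 2 * Λbar * |S₀ x z a b| := by
  rw [conjV_diagK_apply, abs_mul]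
  have h1 : |Λ (blk M z) - Λ (blk M x)| ≤ 2 * Λbar :=
    (abs_sub _ _).trans (by linarith [hΛ (blk M z), hΛ (blk M x)])
  have h0 : 0 ≤ Λbar := (abs_nonneg _).trans (hΛ (blk M x))
  nlinarith [abs_nonneg (S₀ x z a b), abs_nonneg (Λ (blk M z) - Λ (blk M x))]

end BlockConst

/-! ## §2 The (b3) cell with a block-constant table gauge: the seam cell -/

section Cell

variable {l r : Fin (d + 1) → (Fin (d + 1) → ℤ) → Fin (d + 1) → (Fin (d + 1) → ℤ) → ℝ}
  {S : Fin (d + 1) → (Fin (d + 1) → ℤ) → MKer (d + 1) (Fib d)} {S₀ : MKer (d + 1) (Fib d)}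
  (hWard : ∀ (ψ : (Fin (d + 1) → ℤ) → ℝ) (x z : Fin (d + 1) → ℤ) (κ₁ κ₂ : Fin (d + 1)),
    ∑ κ : Fin (d + 1), ∑' u : Fin (d + 1) → ℤ, dz ψ κ u * S κ u x z (Sum.inl κ₁) (Sum.inl κ₂)
      = S₀ x z (Sum.inl κ₁) (Sum.inl κ₂) * (ψ z - ψ x))
  (M : ℕ) (Λ : Fin (d + 1) → (Fin (d + 1) → ℤ) → Site (d + 1) → ℝ)

include hWard in
open Classical in
/-- NOT IN PRINT; OUR BOOKKEEPING.  **THE TABLE VERTEX THROUGH A BLOCK-CONSTANT PURE-GAUGE TABLE LEG IS THE SEAM LETTER**: for the table leg family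
`(ν, U) ↦ dz (Λ_{νU} ∘ blk M)` and a letter family obeying the slot-Ward binder with companion `S₀`,
`vertexW (dz (Λ∘blk)) S ν U x z κ₁ κ₂ = Σ_{B ∈ {blk x, blk z}} Λ_{νU} B · conjV S₀ (diagK 𝟙_{blk · = B}) x z κ₁ κ₂`. -/
theorem vertexW_blockGauge_ff (ν : Fin (d + 1)) (U x z : Fin (d + 1) → ℤ) (κ₁ κ₂ : Fin (d + 1)) :
    vertexW (fun ν U κ u => dz (fun y => Λ ν U (blk M y)) κ u) S ν U x z (Sum.inl κ₁) (Sum.inl κ₂)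
      = ∑ B ∈ ({blk M x, blk M z} : Finset (Site (d + 1))),
          Λ ν U B * conjV S₀ (diagK (fun p _ => if blk M p = B then (1 : ℝ) else 0)) x z (Sum.inl κ₁) (Sum.inl κ₂) := by
  rw [vertexW_gaugeTable_ff_eq_conjV (lam := fun ν U y => Λ ν U (blk M y)) hWard]
  exact conjV_diagK_blockConst_apply S₀ M (Λ ν U) x z _ _

include hWard in
/-- NOT IN PRINT; OUR BOOKKEEPING.  **THE SEAM LETTER VANISHES ON SAME-BLOCK PAIRS** (the table vertex through a block-constant gauge reads only cross-block entries of the companion). -/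
theorem vertexW_blockGauge_ff_of_blk_eq (ν : Fin (d + 1)) (U : Fin (d + 1) → ℤ) {x z : Fin (d + 1) → ℤ} (h : blk M x = blk M z) (κ₁ κ₂ : Fin (d + 1)) :
    vertexW (fun ν U κ u => dz (fun y => Λ ν U (blk M y)) κ u) S ν U x z (Sum.inl κ₁) (Sum.inl κ₂) = 0 := by
  rw [vertexW_gaugeTable_ff_eq_conjV (lam := fun ν U y => Λ ν U (blk M y)) hWard]
  exact conjV_diagK_blockConst_apply_of_blk_eq S₀ M (Λ ν U) h _ _

include hWard in
open Classical in
/-- NOT IN PRINT; OUR BOOKKEEPING (`LayerPushGaugeTable.push₃_gaugeTable_inl_inl` ⨾ §1).  **THE SEAM CELL, ENTRY BY ENTRY**: the (b3) cell with a block-constant table gauge is the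
two-leg sandwich of the superposition of block-indicator commutators —
`push₃ l r (dz (Λ∘blk)) S ν U x′ z′ (inl α) (inl β) = Σ'_z Σ_{κ₂} (Σ'_x Σ_{κ₁} l α x′ κ₁ x · Σ_{B ∈ {blk x, blk z}} Λ_{νU} B · [S₀, 𝟙_B] x z κ₁ κ₂) · r β z′ κ₂ z`. -/
theorem push₃_blockGauge_inl_inl (ν : Fin (d + 1)) (U x' z' : Fin (d + 1) → ℤ) (α β : Fin (d + 1)) :
    push₃ l r (fun ν U κ u => dz (fun y => Λ ν U (blk M y)) κ u) S ν U x' z' (Sum.inl α) (Sum.inl β)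
      = ∑' z : Fin (d + 1) → ℤ, ∑ κ₂ : Fin (d + 1),
          (∑' x : Fin (d + 1) → ℤ, ∑ κ₁ : Fin (d + 1),
            l α x' κ₁ x * ∑ B ∈ ({blk M x, blk M z} : Finset (Site (d + 1))),
              Λ ν U B * conjV S₀ (diagK (fun p _ => if blk M p = B then (1 : ℝ) else 0)) x z (Sum.inl κ₁) (Sum.inl κ₂)) * r β z' κ₂ z := by
  rw [push₃_gaugeTable_inl_inl (lam := fun ν U y => Λ ν U (blk M y)) hWard]
  refine tsum_congr fun z => Finset.sum_congr rfl fun κ₂ _ => ?_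
  congr 1
  refine tsum_congr fun x => Finset.sum_congr rfl fun κ₁ _ => ?_
  have e := conjV_diagK_blockConst_apply S₀ M (Λ ν U) x z (Sum.inl κ₁) (Sum.inl κ₂)
  rw [conjV_diagK_apply] at e
  rw [e]

end Cell

end Summit.QuantumFields.BalabanUV.Beta.GAN24.LayerSeamLetters

end
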